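import Summits.HodgeConjecture.CorCM.IrreducibleOddWeightsMultiClassRank
import HarnessLib

/-!
# The multiplicity formula across all isotypic classes, VI: THE EXACT TWO-BLOCK DEFECT —
# `(⨆_s S(W_s)) ∩ (⨆_t S(W′_t)) = ⨁_c (B_c ∩ B′_c)`, `dim = Σ_c m_c·dim A_c` with `dim(D^S_c ∩ D^{S′}_c) = m_c·δ_c`;
# `rank Σ|_p + rank Σ|_q = rank Σ|_{p∨q} + 1 + Σ_c m_c·dim A_c`

COR-CM (cell `pub-hodgecm2`, binder seat `b16` gen 75, count-neutral claim THE MULTIPLICITY FORMULA ACROSS ALL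
ISOTYPIC CLASSES FOR A WHOLE FAMILY, file M6 — abstract `G`-set level and type ranks; theorems only, no definition,
no named fact, no `sorry`).  NEW as stated, hence under `Summits/`.  HONEST FRAMING: linear algebra of translates of
functions on finite `G`-sets (files M1–M5, gen 72 C4, gen 74 S1/S3/S4); nothing about Hodge classes is asserted,
`HC_CM` is neither used nor asserted.  Gen 74 S1 gave the exact two-block defect `rank Σ|_p + rank Σ|_q =
rank Σ|_{p∨q} + 1 + dim(MC_p ∩ MC_q)` and S4 read it inside ONE isotypic class; gen 70 I11 split the meet of a
PAIR of slots over the classes.  This file splits the meet of two BLOCKS of a family over the classes.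

SETTING (files M1–M5).  Pairwise non-isomorphic reference irreducibles `A_c ≤ ℚ^{Y_c}` (`A_c ≠ 0`, commutant
`𝒟_c` ANY, `δ_c = dim D_c·a₀_c`); two finite families of slots `s ∈ S`, `t ∈ S′` (pivots `Y_s`, `Y′_t`) assembled
from the references: class parts `p^s_c = Σ_j ι^s_{c,j}(b^s_{c,j})`, `p′^t_c`, slot vectors `W_s = Σ_c p^s_c`, `W′_t`;
CLASS BLOCKS `B_c = ⨆_s S(p^s_c)`, `B′_c = ⨆_t S(p′^t_c)` (both `≤ 𝒞_c`, the container of `A_c`); D-spans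
`D^S_c = ⨆_{s,j} D_c·b^s_{c,j}`, `D^{S′}_c`.

* §1 LATTICE: for an INDEPENDENT family `D_c` and `U_c, V_c ≤ D_c`: `(⨆_c U_c) ∩ (⨆_c V_c) = ⨆_c (U_c ∩ V_c)`
  (`iSup_inf_iSup_eq_iSup_inf_of_iSupIndep`; gen 70 I4's binary step iterated) and `dim = Σ_c dim(U_c ∩ V_c)`.
* §2 ONE CLASS, FAMILY AGAINST FAMILY (`exists_finrank_iSup_span_shadowCoeff_inf_iSup_eq_mul`): `∃ m`,
  `dim(D^S ∩ D^{S′}) = m·δ` and `dim((⨆_s S(w_s)) ∩ (⨆_t S(w′_t))) = m·dim A` (C4's pair lemma on the disjoint-union pivots).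
* §3 ALL CLASSES: **`(⨆_s S(W_s)) ∩ (⨆_t S(W′_t)) = ⨆_c (B_c ∩ B′_c)`**, **`dim = Σ_c dim(B_c ∩ B′_c)`**
  (`finrank_iSup_span_shadowCoeff_inf_iSup_eq_sum_of_classes`), and over the commutants
  **`∃ m_c, dim(D^S_c ∩ D^{S′}_c) = m_c·δ_c ∧ dim((⨆_s S(W_s)) ∩ (⨆_t S(W′_t))) = Σ_c m_c·dim A_c`**.
* §4 TYPE RANKS, TWO BLOCKS `p, q ⊆ I` of a family of CM types decomposed over the references:
  **`rank Σ|_p + rank Σ|_q = rank Σ|_{p∨q} + 1 + Σ_c m_c·dim A_c`** with `dim(D^p_c ∩ D^q_c) = m_c·δ_c`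
  (`typeRank_sigmaType_add_eq_add_sum_of_union_of_classes`) — `dim Hg(∏_p A) + dim Hg(∏_q A) − dim Hg(∏_{p∪q} A)`
  is the SUM OVER THE CLASSES of the `D_c`-dimension of the meet of the two blocks' D-spans, times `dim A_c`;
  CM dress `cmFamilyRank_add_cmFamilyRank_eq_add_sum_of_union_of_classes`.

## References

* [Serre1977] J.-P. Serre, *Linear Representations of Finite Groups*, GTM 42, §2.6 (canonical decomposition).
* [Lang2002] S. Lang, *Algebra*, 3rd ed., XVII §1, XVII §3.
* [Gordon1999HodgeAVSurvey] B. B. Gordon, *A survey of the Hodge conjecture for abelian varieties*, §3 Theorem (proof),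
  7.5–7.7.
* [Deligne1982HodgeCycles] P. Deligne, *Hodge cycles on abelian varieties*, LNM 900 (1982), I.5 (p. 53), I Ex. 3.7 (c).
-/

set_option autoImplicit false

noncomputable section

open scoped BigOperators Classical

universe u u₀ u₁ uC uJ uJ' uS v v' v'' vC vY w

namespace Summit.HodgeConjecture.CorCM.IrrOdd

open Literature.NumberTheory.ComplexMultiplication

variable {G : Type w} [Group G]

/-! ### §1 The lattice step for an independent family -/

/-- `D_c` INDEPENDENT, `U_c, V_c ≤ D_c` ⟹ `(sup_{c∈s} U_c) ∩ (sup_{c∈s} V_c) = sup_{c∈s} (U_c ∩ V_c)` (induction on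
`s` by file I4's binary step: `D_a` meets `Σ_{c∈s} D_c` trivially). [folklore] -/
theorem finsetSup_inf_finsetSup_eq_of_iSupIndep {M : Type u} [AddCommGroup M] [Module ℚ M] {C : Type uC}
    {D U V : C → Submodule ℚ M} (hD : iSupIndep D) (hU : ∀ c, U c ≤ D c) (hV : ∀ c, V c ≤ D c) (s : Finset C) :
    s.sup U ⊓ s.sup V = s.sup fun c => U c ⊓ V c := by
  refine Finset.induction_on s ?_ ?_
  · simp
  intro a s ha ih
  rw [Finset.sup_insert, Finset.sup_insert, Finset.sup_insert, ← ih]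
  have hDD : D a ⊓ s.sup D = ⊥ := by
    rw [← disjoint_iff, Finset.sup_eq_iSup]
    exact hD.disjoint_biSup (y := (↑s : Set C)) fun h => ha (Finset.mem_coe.1 h)
  exact sup_inf_sup_eq_of_inf_eq_bot hDD (hU a) (hV a) (Finset.sup_mono_fun fun c _ => hU c)
    (Finset.sup_mono_fun fun c _ => hV c)

/-- **`(⨆_c U_c) ∩ (⨆_c V_c) = ⨆_c (U_c ∩ V_c)`** for `U_c, V_c` inside the members of an INDEPENDENT family `D_c`
(finite label set). [folklore] -/
theorem iSup_inf_iSup_eq_iSup_inf_of_iSupIndep {M : Type u} [AddCommGroup M] [Module ℚ M] {C : Type uC} [Fintype C]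
    {D U V : C → Submodule ℚ M} (hD : iSupIndep D) (hU : ∀ c, U c ≤ D c) (hV : ∀ c, V c ≤ D c) :
    (⨆ c, U c) ⊓ (⨆ c, V c) = ⨆ c, (U c ⊓ V c) := by
  rw [← Finset.sup_univ_eq_iSup, ← Finset.sup_univ_eq_iSup, ← Finset.sup_univ_eq_iSup]
  exact finsetSup_inf_finsetSup_eq_of_iSupIndep hD hU hV Finset.univ

/-- **`dim((⨆_c U_c) ∩ (⨆_c V_c)) = Σ_c dim(U_c ∩ V_c)`** (the meets `U_c ∩ V_c ≤ D_c` are again independent).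
[folklore] -/
theorem finrank_iSup_inf_iSup_eq_sum_of_iSupIndep {M : Type u} [AddCommGroup M] [Module ℚ M] {C : Type uC}
    [Fintype C] {D U V : C → Submodule ℚ M} (hD : iSupIndep D) (hU : ∀ c, U c ≤ D c) (hV : ∀ c, V c ≤ D c)
    [∀ c, Module.Finite ℚ (U c)] :
    Module.finrank ℚ ↥((⨆ c, U c) ⊓ ⨆ c, V c) = ∑ c, Module.finrank ℚ ↥(U c ⊓ V c) := by
  haveI : ∀ c, Module.Finite ℚ ↥(U c ⊓ V c) := fun c =>
    Submodule.finiteDimensional_of_le (inf_le_left : U c ⊓ V c ≤ U c)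
  rw [iSup_inf_iSup_eq_iSup_inf_of_iSupIndep hD hU hV, finrank_iSup_eq_sum_finrank_iff_iSupIndep]
  exact hD.mono fun c => inf_le_left.trans (hU c)

/-! ### §2 One class, family against family: the `D`-multiplicity of the meet -/

/-- **ONE CLASS, FAMILY AGAINST FAMILY**: `A` stable irreducible with ANY commutant, two finite families of pivots
with shadows `w_s = Σ_j ι^s_j(b^s_j)`, `w′_t = Σ_k ι′^t_k(b′^t_k)`.  There is `m` with **`dim((⨆_s D⟨b^s⟩) ∩ (⨆_t D⟨b′^t⟩))
= m·δ` and `dim((⨆_s S(w_s)) ∩ (⨆_t S(w′_t))) = m·dim A`** (C4's pair lemma on the disjoint-union pivots `⊔_s Y_s`,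
`⊔_t Y′_t`, file S3's bookkeeping). [cite: Lang2002, XVII §3] [cite: Serre1977, §2.6]
[cite: Gordon1999HodgeAVSurvey, §3 Theorem (proof), 7.5–7.7] -/
theorem exists_finrank_iSup_span_shadowCoeff_inf_iSup_eq_mul {Y : Type vY} [MulAction G Y] [Fintype Y]
    {A : Submodule ℚ (Y → ℚ)} {𝒟 : Submodule ℚ ((Y → ℚ) →ₗ[ℚ] (Y → ℚ))}
    (h𝒟 : ∀ L : (Y → ℚ) →ₗ[ℚ] (Y → ℚ), L ∈ 𝒟 ↔ (∀ a ∈ A, L a ∈ A) ∧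
      ∀ (k : G) (a : Y → ℚ), a ∈ A → L (fun y => a (k • y)) = fun y => L a (k • y))
    (hAst : ∀ (k : G) (a : Y → ℚ), a ∈ A → (fun y => a (k • y)) ∈ A)
    (hAirr : ∀ W : Submodule ℚ (Y → ℚ), W ≤ A → W ≠ ⊥ →
      (∀ (k : G) (f : Y → ℚ), f ∈ W → (fun y => f (k • y)) ∈ W) → W = A)
    {S : Type uS} [Fintype S] {Yf : S → Type v'} [∀ s, MulAction G (Yf s)] [∀ s, Fintype (Yf s)]
    {Jf : S → Type u₀} [∀ s, Fintype (Jf s)] (ι : ∀ s, Jf s → ((Y → ℚ) →ₗ[ℚ] (Yf s → ℚ)))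
    {S' : Type uS} [Fintype S'] {Yf' : S' → Type v''} [∀ t, MulAction G (Yf' t)] [∀ t, Fintype (Yf' t)]
    {Jf' : S' → Type u₁} [∀ t, Fintype (Jf' t)] (ι' : ∀ t, Jf' t → ((Y → ℚ) →ₗ[ℚ] (Yf' t → ℚ)))
    (hιeq : ∀ s (j : Jf s) (k : G) (a : Y → ℚ), a ∈ A → ι s j (fun y => a (k • y)) = fun y => ι s j a (k • y))
    (hι'eq : ∀ t (j : Jf' t) (k : G) (a : Y → ℚ), a ∈ A → ι' t j (fun y => a (k • y)) = fun y => ι' t j a (k • y))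
    (hind : ∀ s (f : Jf s → (Y → ℚ)), (∀ j, f j ∈ A) → ∑ j, ι s j (f j) = 0 → ∀ j, f j = 0)
    (hind' : ∀ t (f : Jf' t → (Y → ℚ)), (∀ j, f j ∈ A) → ∑ j, ι' t j (f j) = 0 → ∀ j, f j = 0)
    {b : ∀ s, Jf s → (Y → ℚ)} {b' : ∀ t, Jf' t → (Y → ℚ)} (hb : ∀ s j, b s j ∈ A) (hb' : ∀ t j, b' t j ∈ A)
    {a₀ : Y → ℚ} (ha₀ : a₀ ∈ A) (h0 : a₀ ≠ 0) :
    ∃ m : ℕ,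
      Module.finrank ℚ ↥((⨆ s, ⨆ j, 𝒟.map (LinearMap.applyₗ (b s j))) ⊓
          ⨆ t, ⨆ j, 𝒟.map (LinearMap.applyₗ (b' t j))) = m * Module.finrank ℚ ↥(𝒟.map (LinearMap.applyₗ a₀)) ∧
      Module.finrank ℚ
          ↥((⨆ s, Submodule.span ℚ (Set.range fun y : Yf s => fun g : G => (∑ j, ι s j (b s j)) (g • y))) ⊓
            ⨆ t, Submodule.span ℚ (Set.range fun y : Yf' t => fun g : G => (∑ j, ι' t j (b' t j)) (g • y))) =
        m * Module.finrank ℚ A := by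
  obtain ⟨m, hD, hS⟩ := exists_finrank_span_shadowCoeff_inf_eq_mul (Y₀ := Σ s, Yf s) (Y₁ := Σ t, Yf' t)
    (J₀ := Σ s, Jf s) (J₁ := Σ t, Jf' t) h𝒟 hAst hAirr (fun p => slotExt p.1 ∘ₗ ι p.1 p.2)
    (fun q => slotExt q.1 ∘ₗ ι' q.1 q.2) (fun p k a ha => slotExt_comp_apply_translate ι hιeq p k a ha)
    (fun q k a ha => slotExt_comp_apply_translate ι' hι'eq q k a ha)
    (fun f hf hf0 p => sigma_jointly_independent ι hind f hf hf0 p)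
    (fun f hf hf0 q => sigma_jointly_independent ι' hind' f hf hf0 q) (b₀ := fun p => b p.1 p.2)
    (b₁ := fun q => b' q.1 q.2) (fun p => hb p.1 p.2) (fun q => hb' q.1 q.2) ha₀ h0
  rw [iSup_sigma_map_applyₗ, iSup_sigma_map_applyₗ] at hD
  rw [sum_sigma_slotExt_comp_apply, sum_sigma_slotExt_comp_apply, span_shadowCoeff_sigmaLift_eq_iSup,
    span_shadowCoeff_sigmaLift_eq_iSup] at hS
  exact ⟨m, hD, hS⟩

/-! ### §3 All classes: the meet of two families splits over the classes -/

section Classes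

variable {C : Type uC} [Fintype C] {Yc : C → Type vC} [∀ c, MulAction G (Yc c)] [∀ c, Fintype (Yc c)]
  {Ar : ∀ c, Submodule ℚ (Yc c → ℚ)} {𝒟 : ∀ c, Submodule ℚ ((Yc c → ℚ) →ₗ[ℚ] (Yc c → ℚ))}
  {S : Type uS} [Fintype S] {Yf : S → Type v} [∀ s, MulAction G (Yf s)] [∀ s, Fintype (Yf s)]
  {JJ : S → C → Type uJ} [∀ s c, Fintype (JJ s c)]
  {S' : Type uS} [Fintype S'] {Yf' : S' → Type v''} [∀ t, MulAction G (Yf' t)] [∀ t, Fintype (Yf' t)]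
  {JJ' : S' → C → Type uJ'} [∀ t c, Fintype (JJ' t c)]

omit [Fintype S] [Fintype S'] in
/-- **THE MEET OF TWO FAMILIES SPLITS OVER THE CLASSES: `(⨆_s S(W_s)) ∩ (⨆_t S(W′_t)) = ⨆_c (B_c ∩ B′_c)`** with
`B_c = ⨆_s S(p^s_c)`, `B′_c = ⨆_t S(p′^t_c)` the class blocks (both inside the container `𝒞_c`; the containers are
independent, file M2). [cite: Serre1977, §2.6] [cite: Gordon1999HodgeAVSurvey, §3 Theorem (proof), 7.5–7.7] -/
theorem iSup_span_shadowCoeff_inf_iSup_eq_iSup_of_classes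
    (hRst : ∀ c (k : G) (a : Yc c → ℚ), a ∈ Ar c → (fun y => a (k • y)) ∈ Ar c)
    (hRirr : ∀ c (W : Submodule ℚ (Yc c → ℚ)), W ≤ Ar c → W ≠ ⊥ →
      (∀ (k : G) (f : Yc c → ℚ), f ∈ W → (fun y => f (k • y)) ∈ W) → W = Ar c)
    (hsep : ∀ c c' (L : (Yc c → ℚ) →ₗ[ℚ] (Yc c' → ℚ)), c ≠ c' → Ar c ≠ ⊥ → (∀ a ∈ Ar c, L a ∈ Ar c') →
      (∀ a ∈ Ar c, L a = 0 → a = 0) →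
      (∀ (k : G) (a : Yc c → ℚ), a ∈ Ar c → L (fun y => a (k • y)) = fun y => L a (k • y)) → False)
    (ι : ∀ s c, JJ s c → ((Yc c → ℚ) →ₗ[ℚ] (Yf s → ℚ))) (ι' : ∀ t c, JJ' t c → ((Yc c → ℚ) →ₗ[ℚ] (Yf' t → ℚ)))
    (hιeq : ∀ s c (j : JJ s c) (k : G) (a : Yc c → ℚ), a ∈ Ar c →
      ι s c j (fun y => a (k • y)) = fun y => ι s c j a (k • y))
    (hι'eq : ∀ t c (j : JJ' t c) (k : G) (a : Yc c → ℚ), a ∈ Ar c →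
      ι' t c j (fun y => a (k • y)) = fun y => ι' t c j a (k • y))
    (hind : ∀ s c (f : JJ s c → (Yc c → ℚ)), (∀ j, f j ∈ Ar c) → ∑ j, ι s c j (f j) = 0 → ∀ j, f j = 0)
    (hind' : ∀ t c (f : JJ' t c → (Yc c → ℚ)), (∀ j, f j ∈ Ar c) → ∑ j, ι' t c j (f j) = 0 → ∀ j, f j = 0)
    {b : ∀ s c, JJ s c → (Yc c → ℚ)} {b' : ∀ t c, JJ' t c → (Yc c → ℚ)}
    (hb : ∀ s c j, b s c j ∈ Ar c) (hb' : ∀ t c j, b' t c j ∈ Ar c) :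
    (⨆ s, Submodule.span ℚ (Set.range fun y : Yf s => fun g : G => (∑ c, ∑ j, ι s c j (b s c j)) (g • y))) ⊓
        (⨆ t, Submodule.span ℚ
          (Set.range fun y : Yf' t => fun g : G => (∑ c, ∑ j, ι' t c j (b' t c j)) (g • y))) =
      ⨆ c, (⨆ s, Submodule.span ℚ (Set.range fun y : Yf s => fun g : G => (∑ j, ι s c j (b s c j)) (g • y))) ⊓
        ⨆ t, Submodule.span ℚ (Set.range fun y : Yf' t => fun g : G => (∑ j, ι' t c j (b' t c j)) (g • y)) := by
  rw [iSup_span_shadowCoeff_sum_classes_eq_iSup hRst hRirr hsep ι hιeq hind hb,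
    iSup_span_shadowCoeff_sum_classes_eq_iSup hRst hRirr hsep ι' hι'eq hind' hb']
  exact iSup_inf_iSup_eq_iSup_inf_of_iSupIndep (iSupIndep_container_of_classes hRst hRirr hsep)
    (fun c => iSup_span_shadowCoeff_le_container c ι hιeq hb) fun c => iSup_span_shadowCoeff_le_container c ι' hι'eq hb'

omit [Fintype S'] in
/-- **`dim((⨆_s S(W_s)) ∩ (⨆_t S(W′_t))) = Σ_c dim(B_c ∩ B′_c)`** — the defect of two families is the SUM OF THE
CLASS DEFECTS. [cite: Serre1977, §2.6] [cite: Gordon1999HodgeAVSurvey, §3 Theorem (proof), 7.5–7.7] -/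
theorem finrank_iSup_span_shadowCoeff_inf_iSup_eq_sum_of_classes
    (hRst : ∀ c (k : G) (a : Yc c → ℚ), a ∈ Ar c → (fun y => a (k • y)) ∈ Ar c)
    (hRirr : ∀ c (W : Submodule ℚ (Yc c → ℚ)), W ≤ Ar c → W ≠ ⊥ →
      (∀ (k : G) (f : Yc c → ℚ), f ∈ W → (fun y => f (k • y)) ∈ W) → W = Ar c)
    (hsep : ∀ c c' (L : (Yc c → ℚ) →ₗ[ℚ] (Yc c' → ℚ)), c ≠ c' → Ar c ≠ ⊥ → (∀ a ∈ Ar c, L a ∈ Ar c') →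
      (∀ a ∈ Ar c, L a = 0 → a = 0) →
      (∀ (k : G) (a : Yc c → ℚ), a ∈ Ar c → L (fun y => a (k • y)) = fun y => L a (k • y)) → False)
    (ι : ∀ s c, JJ s c → ((Yc c → ℚ) →ₗ[ℚ] (Yf s → ℚ))) (ι' : ∀ t c, JJ' t c → ((Yc c → ℚ) →ₗ[ℚ] (Yf' t → ℚ)))
    (hιeq : ∀ s c (j : JJ s c) (k : G) (a : Yc c → ℚ), a ∈ Ar c →
      ι s c j (fun y => a (k • y)) = fun y => ι s c j a (k • y))
    (hι'eq : ∀ t c (j : JJ' t c) (k : G) (a : Yc c → ℚ), a ∈ Ar c →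
      ι' t c j (fun y => a (k • y)) = fun y => ι' t c j a (k • y))
    (hind : ∀ s c (f : JJ s c → (Yc c → ℚ)), (∀ j, f j ∈ Ar c) → ∑ j, ι s c j (f j) = 0 → ∀ j, f j = 0)
    (hind' : ∀ t c (f : JJ' t c → (Yc c → ℚ)), (∀ j, f j ∈ Ar c) → ∑ j, ι' t c j (f j) = 0 → ∀ j, f j = 0)
    {b : ∀ s c, JJ s c → (Yc c → ℚ)} {b' : ∀ t c, JJ' t c → (Yc c → ℚ)}
    (hb : ∀ s c j, b s c j ∈ Ar c) (hb' : ∀ t c j, b' t c j ∈ Ar c) :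
    Module.finrank ℚ
        ↥((⨆ s, Submodule.span ℚ
            (Set.range fun y : Yf s => fun g : G => (∑ c, ∑ j, ι s c j (b s c j)) (g • y))) ⊓
          ⨆ t, Submodule.span ℚ
            (Set.range fun y : Yf' t => fun g : G => (∑ c, ∑ j, ι' t c j (b' t c j)) (g • y))) =
      ∑ c, Module.finrank ℚ
        ↥((⨆ s, Submodule.span ℚ (Set.range fun y : Yf s => fun g : G => (∑ j, ι s c j (b s c j)) (g • y))) ⊓
          ⨆ t, Submodule.span ℚ (Set.range fun y : Yf' t => fun g : G => (∑ j, ι' t c j (b' t c j)) (g • y))) := by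
  haveI : ∀ s c, Module.Finite ℚ
      ↥(Submodule.span ℚ (Set.range fun y : Yf s => fun g : G => (∑ j, ι s c j (b s c j)) (g • y))) :=
    fun s c => Module.Finite.span_of_finite ℚ (Set.finite_range _)
  haveI : ∀ c, Module.Finite ℚ ↥(⨆ s, Submodule.span ℚ
      (Set.range fun y : Yf s => fun g : G => (∑ j, ι s c j (b s c j)) (g • y))) := fun c =>
    Submodule.finite_iSup _
  rw [iSup_span_shadowCoeff_sum_classes_eq_iSup hRst hRirr hsep ι hιeq hind hb,
    iSup_span_shadowCoeff_sum_classes_eq_iSup hRst hRirr hsep ι' hι'eq hind' hb']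
  exact finrank_iSup_inf_iSup_eq_sum_of_iSupIndep (iSupIndep_container_of_classes hRst hRirr hsep)
    (fun c => iSup_span_shadowCoeff_le_container c ι hιeq hb) fun c => iSup_span_shadowCoeff_le_container c ι' hι'eq hb'

/-- **THE DEFECT OF TWO FAMILIES OVER THE COMMUTANTS**: there are `m_c` with **`dim(D^S_c ∩ D^{S′}_c) = m_c·δ_c` and
`dim((⨆_s S(W_s)) ∩ (⨆_t S(W′_t))) = Σ_c m_c·dim A_c`** — class by class, the `D_c`-dimension of the meet of the two
blocks' D-spans, times `dim A_c`. [cite: Lang2002, XVII §3] [cite: Serre1977, §2.6]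
[cite: Gordon1999HodgeAVSurvey, §3 Theorem (proof), 7.5–7.7] -/
theorem exists_finrank_iSup_span_shadowCoeff_inf_iSup_eq_sum_of_classes
    (h𝒟 : ∀ c (L : (Yc c → ℚ) →ₗ[ℚ] (Yc c → ℚ)), L ∈ 𝒟 c ↔ (∀ a ∈ Ar c, L a ∈ Ar c) ∧
      ∀ (k : G) (a : Yc c → ℚ), a ∈ Ar c → L (fun y => a (k • y)) = fun y => L a (k • y))
    (hRst : ∀ c (k : G) (a : Yc c → ℚ), a ∈ Ar c → (fun y => a (k • y)) ∈ Ar c)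
    (hRirr : ∀ c (W : Submodule ℚ (Yc c → ℚ)), W ≤ Ar c → W ≠ ⊥ →
      (∀ (k : G) (f : Yc c → ℚ), f ∈ W → (fun y => f (k • y)) ∈ W) → W = Ar c)
    (hsep : ∀ c c' (L : (Yc c → ℚ) →ₗ[ℚ] (Yc c' → ℚ)), c ≠ c' → Ar c ≠ ⊥ → (∀ a ∈ Ar c, L a ∈ Ar c') →
      (∀ a ∈ Ar c, L a = 0 → a = 0) →
      (∀ (k : G) (a : Yc c → ℚ), a ∈ Ar c → L (fun y => a (k • y)) = fun y => L a (k • y)) → False)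
    (ι : ∀ s c, JJ s c → ((Yc c → ℚ) →ₗ[ℚ] (Yf s → ℚ))) (ι' : ∀ t c, JJ' t c → ((Yc c → ℚ) →ₗ[ℚ] (Yf' t → ℚ)))
    (hιeq : ∀ s c (j : JJ s c) (k : G) (a : Yc c → ℚ), a ∈ Ar c →
      ι s c j (fun y => a (k • y)) = fun y => ι s c j a (k • y))
    (hι'eq : ∀ t c (j : JJ' t c) (k : G) (a : Yc c → ℚ), a ∈ Ar c →
      ι' t c j (fun y => a (k • y)) = fun y => ι' t c j a (k • y))
    (hind : ∀ s c (f : JJ s c → (Yc c → ℚ)), (∀ j, f j ∈ Ar c) → ∑ j, ι s c j (f j) = 0 → ∀ j, f j = 0)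
    (hind' : ∀ t c (f : JJ' t c → (Yc c → ℚ)), (∀ j, f j ∈ Ar c) → ∑ j, ι' t c j (f j) = 0 → ∀ j, f j = 0)
    {b : ∀ s c, JJ s c → (Yc c → ℚ)} {b' : ∀ t c, JJ' t c → (Yc c → ℚ)}
    (hb : ∀ s c j, b s c j ∈ Ar c) (hb' : ∀ t c j, b' t c j ∈ Ar c)
    {a₀ : ∀ c, Yc c → ℚ} (ha₀ : ∀ c, a₀ c ∈ Ar c) (h0 : ∀ c, a₀ c ≠ 0) :
    ∃ m : C → ℕ,
      (∀ c, Module.finrank ℚ ↥((⨆ s, ⨆ j, (𝒟 c).map (LinearMap.applyₗ (b s c j))) ⊓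
          ⨆ t, ⨆ j, (𝒟 c).map (LinearMap.applyₗ (b' t c j))) =
        m c * Module.finrank ℚ ↥((𝒟 c).map (LinearMap.applyₗ (a₀ c)))) ∧
      Module.finrank ℚ
          ↥((⨆ s, Submodule.span ℚ
              (Set.range fun y : Yf s => fun g : G => (∑ c, ∑ j, ι s c j (b s c j)) (g • y))) ⊓
            ⨆ t, Submodule.span ℚ
              (Set.range fun y : Yf' t => fun g : G => (∑ c, ∑ j, ι' t c j (b' t c j)) (g • y))) =
        ∑ c, m c * Module.finrank ℚ (Ar c) := by
  choose m hD hS using fun c => exists_finrank_iSup_span_shadowCoeff_inf_iSup_eq_mul (Yf := Yf) (Yf' := Yf')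
    (h𝒟 c) (hRst c) (hRirr c) (fun s => ι s c) (fun t => ι' t c) (fun s => hιeq s c) (fun t => hι'eq t c)
    (fun s => hind s c) (fun t => hind' t c) (fun s => hb s c) (fun t => hb' t c) (ha₀ c) (h0 c)
  refine ⟨m, hD, ?_⟩
  rw [finrank_iSup_span_shadowCoeff_inf_iSup_eq_sum_of_classes hRst hRirr hsep ι ι' hιeq hι'eq hind hind' hb hb']
  exact Finset.sum_congr rfl fun c _ => hS c

end Classes

/-! ### §4 Type ranks: the exact two-block defect across all classes -/

section Family

variable {I : Type u} {E : I → Type v} [∀ i, MulAction G (E i)] [∀ i, Fintype (E i)] [Fintype I]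
  [∀ i, Nonempty (E i)]
  {C : Type uC} [Fintype C] {Yc : C → Type vC} [∀ c, MulAction G (Yc c)] [∀ c, Fintype (Yc c)]
  {Ar : ∀ c, Submodule ℚ (Yc c → ℚ)} {𝒟 : ∀ c, Submodule ℚ ((Yc c → ℚ) →ₗ[ℚ] (Yc c → ℚ))}
  {JJ : I → C → Type uJ} [∀ i c, Fintype (JJ i c)]

/-- **THE EXACT TWO-BLOCK DEFECT ACROSS ALL ISOTYPIC CLASSES**: for two blocks `p, q ⊆ I` (and `r = p ∪ q`) of a
family of CM types whose type vectors are decomposed over pairwise non-isomorphic references, there are `m_c` with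
`dim(D^p_c ∩ D^q_c) = m_c·δ_c` and **`rank Σ|_p + rank Σ|_q = rank Σ|_{p∪q} + 1 + Σ_c m_c·dim A_c`** —
`dim Hg(∏_p A_i) + dim Hg(∏_q A_i) − dim Hg(∏_{p∪q} A_i) = Σ_c m_c·dim A_c` (gen 74 S1's `dim(MC_p ∩ MC_q)`, split over
the classes). [cite: Deligne1982HodgeCycles, I.5 (p. 53) and I Ex. 3.7 (c)] [cite: Gordon1999HodgeAVSurvey, 7.5–7.7]
[cite: Lang2002, XVII §3] -/
theorem typeRank_sigmaType_add_eq_add_sum_of_union_of_classes {ρ : G} {Φ : ∀ i, Set (E i)}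
    (h : ∀ i, IsCMTypeWith ρ (Φ i)) (p q r : I → Prop) (hr : ∀ i, r i ↔ p i ∨ q i)
    [Nonempty {i // p i}] [Nonempty {i // q i}]
    (h𝒟 : ∀ c (L : (Yc c → ℚ) →ₗ[ℚ] (Yc c → ℚ)), L ∈ 𝒟 c ↔ (∀ a ∈ Ar c, L a ∈ Ar c) ∧
      ∀ (k : G) (a : Yc c → ℚ), a ∈ Ar c → L (fun y => a (k • y)) = fun y => L a (k • y))
    (hRst : ∀ c (k : G) (a : Yc c → ℚ), a ∈ Ar c → (fun y => a (k • y)) ∈ Ar c)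
    (hRirr : ∀ c (W : Submodule ℚ (Yc c → ℚ)), W ≤ Ar c → W ≠ ⊥ →
      (∀ (k : G) (f : Yc c → ℚ), f ∈ W → (fun y => f (k • y)) ∈ W) → W = Ar c)
    (hsep : ∀ c c' (L : (Yc c → ℚ) →ₗ[ℚ] (Yc c' → ℚ)), c ≠ c' → Ar c ≠ ⊥ → (∀ a ∈ Ar c, L a ∈ Ar c') →
      (∀ a ∈ Ar c, L a = 0 → a = 0) →
      (∀ (k : G) (a : Yc c → ℚ), a ∈ Ar c → L (fun y => a (k • y)) = fun y => L a (k • y)) → False)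
    (ι : ∀ i c, JJ i c → ((Yc c → ℚ) →ₗ[ℚ] (E i → ℚ)))
    (hιeq : ∀ i c (j : JJ i c) (k : G) (a : Yc c → ℚ), a ∈ Ar c →
      ι i c j (fun y => a (k • y)) = fun y => ι i c j a (k • y))
    (hind : ∀ i c (f : JJ i c → (Yc c → ℚ)), (∀ j, f j ∈ Ar c) → ∑ j, ι i c j (f j) = 0 → ∀ j, f j = 0)
    {b : ∀ i c, JJ i c → (Yc c → ℚ)} (hb : ∀ i c j, b i c j ∈ Ar c)
    (hu : ∀ i, antiVec (Φ i) (1 : G) = ∑ c, ∑ j, ι i c j (b i c j))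
    {a₀ : ∀ c, Yc c → ℚ} (ha₀ : ∀ c, a₀ c ∈ Ar c) (h0 : ∀ c, a₀ c ≠ 0) :
    ∃ m : C → ℕ,
      (∀ c, Module.finrank ℚ ↥((⨆ i : {i // p i}, ⨆ j, (𝒟 c).map (LinearMap.applyₗ (b i.1 c j))) ⊓
          ⨆ i : {i // q i}, ⨆ j, (𝒟 c).map (LinearMap.applyₗ (b i.1 c j))) =
        m c * Module.finrank ℚ ↥((𝒟 c).map (LinearMap.applyₗ (a₀ c)))) ∧
      typeRank G (sigmaType fun j : {i // p i} => Φ j.1) + typeRank G (sigmaType fun j : {i // q i} => Φ j.1) =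
        typeRank G (sigmaType fun j : {i // r i} => Φ j.1) + 1 + ∑ c, m c * Module.finrank ℚ (Ar c) := by
  obtain ⟨⟨i₁, hi₁⟩⟩ := ‹Nonempty {i // p i}›
  obtain ⟨⟨i₂, hi₂⟩⟩ := ‹Nonempty {i // q i}›
  haveI : Nonempty (Σ j : {i // p i}, E j.1) := ⟨⟨⟨i₁, hi₁⟩, Classical.arbitrary (E i₁)⟩⟩
  haveI : Nonempty (Σ j : {i // q i}, E j.1) := ⟨⟨⟨i₂, hi₂⟩, Classical.arbitrary (E i₂)⟩⟩
  obtain ⟨m, hD, hS⟩ := exists_finrank_iSup_span_shadowCoeff_inf_iSup_eq_sum_of_classes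
    (Yf := fun j : {i // p i} => E j.1) (Yf' := fun j : {i // q i} => E j.1) h𝒟 hRst hRirr hsep
    (fun j c => ι j.1 c) (fun j c => ι j.1 c) (fun j c => hιeq j.1 c) (fun j c => hιeq j.1 c) (fun j c => hind j.1 c)
    (fun j c => hind j.1 c) (fun j c => hb j.1 c) (fun j c => hb j.1 c) ha₀ h0
  refine ⟨m, hD, ?_⟩
  have hblock := typeRank_sigmaType_add_typeRank_sigmaType_eq_of_union h p q r hr
  have hsub : ∀ t : I → Prop,
      (⨆ j : {i // t i}, Submodule.span ℚ (Set.range fun x : E j.1 => fun g : G => antiVec (Φ j.1) g x)) =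
        ⨆ j : {i // t i}, Submodule.span ℚ
          (Set.range fun x : E j.1 => fun g : G => (∑ c, ∑ k, ι j.1 c k (b j.1 c k)) (g • x)) :=
    fun t => iSup_congr fun j => span_coeff_eq_span_shadowCoeff_of_eq Φ j.1 (hu j.1)
  rw [hsub p, hsub q] at hblock
  rw [hblock, hS]

end Family

end Summit.HodgeConjecture.CorCM.IrrOdd

/-! ### CM dress -/

namespace Summit.HodgeConjecture.CorCM

open CategoryTheory CategoryTheory.Limits NumberField Module IntermediateField
open Literature.NumberTheory.ComplexMultiplication
open Literature.AlgebraicGeometry.Motives (AbelianVariety CMType)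
open Literature.AlgebraicGeometry.Motives.AbelianVariety
open Literature.AlgebraicGeometry.HodgeTheory
open Literature.AlgebraicGeometry.ComplexMultiplication (IsCMTypeRealisation)
open Literature.AlgebraicGeometry.Pohlmann1968

variable {I : Type} [Fintype I] {K : I → Type} [∀ i, Field (K i)] [∀ i, NumberField (K i)] [∀ i, IsCMField (K i)]
  {C : Type} [Fintype C] {Yc : C → Type} [∀ c, MulAction (ℂ ≃+* ℂ) (Yc c)] [∀ c, Fintype (Yc c)]
  {Ar : ∀ c, Submodule ℚ (Yc c → ℚ)} {𝒟 : ∀ c, Submodule ℚ ((Yc c → ℚ) →ₗ[ℚ] (Yc c → ℚ))}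
  {JJ : I → C → Type} [∀ i c, Fintype (JJ i c)]

/-- **THE EXACT TWO-BLOCK DEFECT FOR PRODUCTS OF CM ABELIAN VARIETIES ACROSS ALL ISOTYPIC CLASSES**: for non-empty
`S, T ⊆ I` there are `m_c` with `dim(D^S_c ∩ D^T_c) = m_c·δ_c` and **`cmFamilyRank Φ|_S + cmFamilyRank Φ|_T =
cmFamilyRank Φ|_{S∪T} + 1 + Σ_c m_c·dim A_c`** — `dim Hg(∏_S A_i) + dim Hg(∏_T A_i) − dim Hg(∏_{S∪T} A_i) =
Σ_c m_c·dim A_c`. [cite: Deligne1982HodgeCycles, I.5 (p. 53) and I Ex. 3.7 (c)] [cite: Gordon1999HodgeAVSurvey,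
7.5–7.7] [cite: Lang2002, XVII §3] -/
theorem cmFamilyRank_add_cmFamilyRank_eq_add_sum_of_union_of_classes (Φ : ∀ i, CMType (K i)) (S T : Finset I)
    (hS : S.Nonempty) (hT : T.Nonempty)
    (h𝒟 : ∀ c (L : (Yc c → ℚ) →ₗ[ℚ] (Yc c → ℚ)), L ∈ 𝒟 c ↔ (∀ a ∈ Ar c, L a ∈ Ar c) ∧
      ∀ (k : ℂ ≃+* ℂ) (a : Yc c → ℚ), a ∈ Ar c → L (fun y => a (k • y)) = fun y => L a (k • y))
    (hRst : ∀ c (k : ℂ ≃+* ℂ) (a : Yc c → ℚ), a ∈ Ar c → (fun y => a (k • y)) ∈ Ar c)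
    (hRirr : ∀ c (W : Submodule ℚ (Yc c → ℚ)), W ≤ Ar c → W ≠ ⊥ →
      (∀ (k : ℂ ≃+* ℂ) (f : Yc c → ℚ), f ∈ W → (fun y => f (k • y)) ∈ W) → W = Ar c)
    (hsep : ∀ c c' (L : (Yc c → ℚ) →ₗ[ℚ] (Yc c' → ℚ)), c ≠ c' → Ar c ≠ ⊥ → (∀ a ∈ Ar c, L a ∈ Ar c') →
      (∀ a ∈ Ar c, L a = 0 → a = 0) →
      (∀ (k : ℂ ≃+* ℂ) (a : Yc c → ℚ), a ∈ Ar c → L (fun y => a (k • y)) = fun y => L a (k • y)) → False)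
    (ι : ∀ i c, JJ i c → ((Yc c → ℚ) →ₗ[ℚ] ((K i →+* ℂ) → ℚ)))
    (hιeq : ∀ i c (j : JJ i c) (k : ℂ ≃+* ℂ) (a : Yc c → ℚ), a ∈ Ar c →
      ι i c j (fun y => a (k • y)) = fun y => ι i c j a (k • y))
    (hind : ∀ i c (f : JJ i c → (Yc c → ℚ)), (∀ j, f j ∈ Ar c) → ∑ j, ι i c j (f j) = 0 → ∀ j, f j = 0)
    {b : ∀ i c, JJ i c → (Yc c → ℚ)} (hb : ∀ i c j, b i c j ∈ Ar c)
    (hu : ∀ i, antiVec (Φ i).1 (1 : ℂ ≃+* ℂ) = ∑ c, ∑ j, ι i c j (b i c j))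
    {a₀ : ∀ c, Yc c → ℚ} (ha₀ : ∀ c, a₀ c ∈ Ar c) (h0 : ∀ c, a₀ c ≠ 0) :
    ∃ m : C → ℕ,
      (∀ c, Module.finrank ℚ ↥((⨆ i : S, ⨆ j, (𝒟 c).map (LinearMap.applyₗ (b i.1 c j))) ⊓
          ⨆ i : T, ⨆ j, (𝒟 c).map (LinearMap.applyₗ (b i.1 c j))) =
        m c * Module.finrank ℚ ↥((𝒟 c).map (LinearMap.applyₗ (a₀ c)))) ∧
      CMAlgebra.cmFamilyRank (fun j : S => Φ j.1) + CMAlgebra.cmFamilyRank (fun j : T => Φ j.1) =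
        CMAlgebra.cmFamilyRank (fun j : ↥(S ∪ T) => Φ j.1) + 1 + ∑ c, m c * Module.finrank ℚ (Ar c) := by
  haveI : Nonempty {j // j ∈ S} := hS.coe_sort
  haveI : Nonempty {j // j ∈ T} := hT.coe_sort
  haveI : ∀ i, Nonempty (K i →+* ℂ) := fun i => inferInstance
  exact IrrOdd.typeRank_sigmaType_add_eq_add_sum_of_union_of_classes (G := ℂ ≃+* ℂ) (E := fun i => K i →+* ℂ)
    (Φ := fun i => (Φ i).1) (fun i => isCMTypeWith_conj (Φ i)) (fun i => i ∈ S) (fun i => i ∈ T)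
    (fun i => i ∈ S ∪ T) (fun i => Finset.mem_union) h𝒟 hRst hRirr hsep ι hιeq hind hb hu ha₀ h0

end Summit.HodgeConjecture.CorCM

end
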